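/-
Copyright (c) 2026 the pub-hodgecm-mathlib formalisation cell (harness21).  Prover seat hodgecm-mathlib-K2E1-p13 (g5), Track B ∕ K2-LIT, h413 = `stmt-HodgeConjecture-24833`,
R90-TF section S8 «ContSpec-n½» (dealer R90-CS-plan (g3), S8-R131 (7) ∕ S8-R144 sequel; census `R90/S8/CENSUS-IwasawaSplitU3.K2E1-p13-g5.md`): the SPLIT-place `hsp` ∃-WITNESS of ★
`K2E1ChiLocalMeansOfShellU3Letters.hsp_of_torusEntries` ASSEMBLED from ★ `K2E1BigCellIwasawaTorusEntrySplitU3` (this seat, p863467) — companion LETTERS file.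
-/
import Summits.HodgeConjecture.HodgeConjecture.Theorems.K2E1BigCellIwasawaTorusEntrySplitU3   -- ★ p863467 (this seat): `exists_iwasawa_torusEntries_split` (factorisation + (α)-letters)
import HarnessLib

/-!
# K2·E1 ∕ R90·S8 — `K2E1BigCellIwasawaTorusEntrySplitU3Letters`: THE SPLIT-PLACE `hsp` ∃-WITNESS (`∃ χ₁ χ₂ π α₁ α₂ c₁ c₂, …` — all twelve clauses of ★ `hsp_of_torusEntries`'s `hT`)
# FROM THE IWASAWA TORUS ENTRIES, for a weight `ω` READ ON THE BOREL PART of ANY factorisation `w₀·n(Φp) = b·k` (`ω(p) = χ₁(b₂₂⁻¹)·χ₂(b₀₀)`)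

Cell `pub/hodgecm-mathlib`, crux h413 = `stmt-HodgeConjecture-24833`, route of record `HCCMUnconditional`; R90-TF section S8 «ContSpec-n½», road R2-χ₃ (the (V) scalar road:
★ (a-1) `K2E1ChiIntertwiningScalarEulerProductU3Finite` ← ★ `K2E1ChiLocalMeansOfShellU3Letters.hsp_of_torusEntries` (`hT`) ← THIS FILE ← ★ `K2E1BigCellIwasawaTorusEntrySplitU3`).
THEOREMS ONLY (no `def`, no `instance`, no notation, no named-fact hypothesis, no `sorry`; default heartbeats); lane `--supports stmt-HodgeConjecture-24833 --as helper` (count-neutral).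
Closes no socket.  Generic non-archimedean local field `F` (= `L⁺_v` at a split place; `δ₁ = δ_w =` ★ `splitSqrt … v w` in the consumer), ANY `δ₁`.

THE MATHEMATICS ([Casselman1980] §3; [Langlands1971] §3; [Bump1997] Prop. 4.5.2; [Rogawski1990] §4.5 p. 45, §13.9 p. 229).  ★ p863467 factorises the big cell
`w₀ · n(Φp) = b(p) · k(p)` (`k(p) ∈ GL₃(𝒪)`, `b(p)` upper triangular) with `α₁ p := b(p)₂₂⁻¹`, `α₂ p := b(p)₀₀` and the TORUS-ENTRY LETTERS `‖α₁ p‖·A(p) = 1`, `‖α₂ p‖·B(p) = 1` for ALL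
`p` (`A, B` the two Gindikin–Karpelevich heights in base coordinates).  For a pair of UNRAMIFIED characters `χ₁, χ₂` of `F^×` (trivial on `{‖u‖ = 1}`) and a weight `ω : F³ → ℂ` that an
unramified Borel datum reads on the Borel part of the big cell — HYPOTHESIS `hω`: for EVERY factorisation `w₀·n(Φp) = b·k` (`b ∈ B(F)`, `k ∈ GL₃(𝒪)`) with `b₀₀ = t₀`, `b₂₂ = t₂`,
`ω(p) = χ₁(t₂⁻¹)·χ₂(t₀)` (this is what `φ(b g) = χ(b)·φ(g)` plus right-`GL₃(𝒪)`-invariance give for the χ-section read through ★ `localSplitEquiv`; the supplier's one-line discharge) —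
the weights `c_j := χ_j ∘ α_j` satisfy the letters (c) (`c_j = 1` on the unit shell BY UNRAMIFIEDNESS, since `‖α_j‖ = 1` there) and `ω = c₁·c₂`.  HEAD:
* **`exists_hsp_witness_split`** — for unramified `χ₁ χ₂`, a uniformizer `π` (`‖π‖ = q⁻¹`) with `(χ₁ π : ℂ) = e₁`, `(χ₂ π : ℂ) = e₂` (the identifications as PARAMETERS), and `ω` with `hω`:
  `∃ χ₁ χ₂ π α₁ α₂ c₁ c₂, hχ₁ ∧ hχ₂ ∧ hπ ∧ (χ₁ π = e₁) ∧ (χ₂ π = e₂) ∧ hα₁ ∧ hα₂ ∧ hc₁1 ∧ hc₁A ∧ hc₂1 ∧ hc₂B ∧ (∀ p, ω p = c₁ p · c₂ p)` — the body of ★ `hsp_of_torusEntries`'s `hT v hv w hw`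
  byte for byte at `F := L⁺_v`, `δ₁ := δ_w`, `(e₁, e₂) :=` the two local values of `φ`.
* `normAbs_torusEntry_eq_one_of_height_eq_one` (the unit shell: `‖α‖·Q = 1 ∧ Q = 1 ⇒ ‖α‖ = 1`), `chi_torusEntry_eq_one_of_height_eq_one` ((c) on the unit shell).
IDENTIFICATION NOTE (census §5, module docstring of ★ p863467): with `J = Φ₃` the `U(2,1)` first torus entry of the Borel part is `(b₀₀, τ(b₂₂)⁻¹) ∈ L_w^× × L_w̄^×`, so for the
χ-section of a Hecke character `φ` the character on `α₁ = b₂₂⁻¹` (height `A_w`) is `φ_w̄ ∘ ι_w̄` and the one on `α₂ = b₀₀` (height `B_w`) is `φ_w ∘ ι_w`: instantiate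
`(e₁, e₂) = (φ(ϖ_w̄), φ(ϖ_w))` and use ★ `splitToken_symm`, or the primed variant of ★ `hsp_of_torusEntries` with `he₁ ∕ he₂` swapped — the dealer's ruling; this file is agnostic.
HONEST LABEL: HC_CM is proved only modulo the 7 printed citations (2 remaining named inputs: hLiu418 = `stmt-HodgeConjecture-24832`, h413 = `stmt-HodgeConjecture-24833`) until rung 0
closes; REL ≠ ★ ≠ BUILT; this file asserts no named fact and closes no socket; count-neutral; pure packaging over ★ p863467 (`intro ∕ obtain ∕ exact`).

## References
* [Casselman1980] W. Casselman, *The unramified principal series of p-adic groups I*, Compositio Math. 40 (1980): §3.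
* [Langlands1971] R. P. Langlands, *Euler Products*, Yale (1971): §3.
* [Bump1997] D. Bump, *Automorphic Forms and Representations* (1997): Prop. 4.5.2.
* [Rogawski1990] J. D. Rogawski, *Automorphic Representations of Unitary Groups in Three Variables*, Ann. of Math. Stud. 123 (1990): §4.5 p. 45, §13.9 p. 229.
-/

set_option autoImplicit false
set_option linter.dupNamespace false -- the mandated namespace repeats `HodgeConjecture.HodgeConjecture`

noncomputable section

open scoped NNReal Matrix
open Literature.NumberTheory.Automorphic
open Literature.NumberTheory.GaloisRepresentations Literature.NumberTheory.GaloisRepresentations.IsNonarchimedeanLocalField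
open Summit.HodgeConjecture.HodgeConjecture.Cruxes.H413.K2E1BigCellIwasawaTorusEntrySplitU3 (exists_iwasawa_torusEntries_split)

namespace Summit.HodgeConjecture.HodgeConjecture.Cruxes.H413.K2E1BigCellIwasawaTorusEntrySplitU3Letters

variable {F : Type*} [Field F] [ValuativeRel F] [TopologicalSpace F] [IsNonarchimedeanLocalField F]

/-! ## §1 The unit shell: a torus entry of norm `Q⁻¹` is a unit where `Q = 1`, and an unramified character is `1` on it -/

/-- **On the unit shell the torus entry is a unit**: `‖α‖·Q = 1` and `Q = 1` give `‖α‖ = 1` (any real height `Q`). [cite: Casselman1980, §3] -/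
theorem normAbs_torusEntry_eq_one_of_height_eq_one {α : Fˣ} {Q : ℝ} (hα : ((normAbs F (α : F) : ℝ≥0) : ℝ) * Q = 1) (hQ : Q = 1) :
    normAbs F (α : F) = 1 := by
  rw [hQ, mul_one] at hα
  exact_mod_cast hα

/-- **Letter (c) on the unit shell**: an UNRAMIFIED character (`χ u = 1` for `‖u‖ = 1`) is `1` on a torus entry of norm `Q⁻¹` where `Q = 1`. [cite: Casselman1980, §3] -/
theorem chi_torusEntry_eq_one_of_height_eq_one (χ : Fˣ →* ℂˣ) (hχ : ∀ u : Fˣ, normAbs F (u : F) = 1 → χ u = 1) {α : Fˣ} {Q : ℝ}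
    (hα : ((normAbs F (α : F) : ℝ≥0) : ℝ) * Q = 1) (hQ : Q = 1) : ((χ α : ℂˣ) : ℂ) = 1 := by
  rw [hχ α (normAbs_torusEntry_eq_one_of_height_eq_one hα hQ), Units.val_one]

/-! ## §2 HEAD: the `hsp` ∃-witness assembled -/

/-- **THE SPLIT-PLACE `hsp` ∃-WITNESS** — the body of ★ `K2E1ChiLocalMeansOfShellU3Letters.hsp_of_torusEntries`'s hypothesis `hT v hv w hw`, byte for byte over a generic
non-archimedean local field `F` (`:= L⁺_v`) in the base coordinates `Φ(p) = (p₀ + δ₁p₁, −(p₀ − δ₁p₁), δ₁p₂ − ½(p₀+δ₁p₁)(p₀−δ₁p₁))` (`δ₁ := δ_w`), with the identifications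
`(χ₁ π : ℂ) = e₁`, `(χ₂ π : ℂ) = e₂` as PARAMETERS.  Inputs: `w₀` of matrix `antidiag(1,1,1)` and the family `n(p)` of matrix `(1 x z; 0 1 y; 0 0 1)` at `Φ(p)` (any terms); UNRAMIFIED
characters `χ₁ χ₂` of `F^×`; a uniformizer `π`; a weight `ω` READ ON THE BOREL PART of every factorisation `w₀·n(Φp) = b·k`, `b ∈ B(F)`, `k ∈ GL₃(𝒪)`: `ω(p) = χ₁(b₂₂⁻¹)·χ₂(b₀₀)` (`hω`).
Output: `∃ χ₁ χ₂ π α₁ α₂ c₁ c₂` with the twelve clauses `hχ₁ hχ₂ hπ he₁ he₂ hα₁ hα₂ hc₁1 hc₁A hc₂1 hc₂B hω` — torus entries from ★ `exists_iwasawa_torusEntries_split`, `c_j := χ_j ∘ α_j`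
((c) on the unit shell by unramifiedness, §1). [cite: Casselman1980, §3] [cite: Langlands1971, §3] [cite: Bump1997, Prop. 4.5.2] [cite: Rogawski1990, §13.9 p. 229] -/
theorem exists_hsp_witness_split (δ₁ : F) {w₀ : GL (Fin 3) F} (hw₀ : (w₀ : Matrix (Fin 3) (Fin 3) F) = !![(0 : F), 0, 1; 0, 1, 0; 1, 0, 0])
    (n : (Fin 3 → F) → GL (Fin 3) F)
    (hn : ∀ p : Fin 3 → F, (n p : Matrix (Fin 3) (Fin 3) F) =
      !![1, p 0 + δ₁ * p 1, δ₁ * p 2 - 2⁻¹ * (p 0 + δ₁ * p 1) * (p 0 - δ₁ * p 1); 0, 1, -(p 0 - δ₁ * p 1); 0, 0, 1])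
    (χ₁ χ₂ : Fˣ →* ℂˣ) (hχ₁ : ∀ u : Fˣ, normAbs F (u : F) = 1 → χ₁ u = 1) (hχ₂ : ∀ u : Fˣ, normAbs F (u : F) = 1 → χ₂ u = 1)
    (π : Fˣ) (hπ : normAbs F (π : F) = (residueFieldCard F : ℝ≥0)⁻¹) {e₁ e₂ : ℂ} (he₁ : ((χ₁ π : ℂˣ) : ℂ) = e₁) (he₂ : ((χ₂ π : ℂˣ) : ℂ) = e₂)
    (ω : (Fin 3 → F) → ℂ)
    (hω : ∀ (p : Fin 3 → F) (b k : GL (Fin 3) F) (t₀ t₂ : Fˣ), b ∈ standardParabolicGL F (id : Fin 3 → Fin 3) → k ∈ glInt 3 F → w₀ * n p = b * k →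
      (b : Matrix (Fin 3) (Fin 3) F) 0 0 = (t₀ : F) → (b : Matrix (Fin 3) (Fin 3) F) 2 2 = (t₂ : F) → ω p = ((χ₁ t₂⁻¹ : ℂˣ) : ℂ) * ((χ₂ t₀ : ℂˣ) : ℂ)) :
    ∃ (χ₁ χ₂ : Fˣ →* ℂˣ) (π : Fˣ) (α₁ α₂ : (Fin 3 → F) → Fˣ) (c₁ c₂ : (Fin 3 → F) → ℂ),
      (∀ u : Fˣ, normAbs F (u : F) = 1 → χ₁ u = 1) ∧
      (∀ u : Fˣ, normAbs F (u : F) = 1 → χ₂ u = 1) ∧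
      normAbs F (π : F) = (residueFieldCard F : ℝ≥0)⁻¹ ∧
      ((χ₁ π : ℂˣ) : ℂ) = e₁ ∧ ((χ₂ π : ℂˣ) : ℂ) = e₂ ∧
      (∀ p : Fin 3 → F, 1 < max 1 (max ((normAbs F (p 0 + δ₁ * p 1) : ℝ≥0) : ℝ) ((normAbs F (δ₁ * p 2 - 2⁻¹ * (p 0 + δ₁ * p 1) * (p 0 - δ₁ * p 1)) : ℝ≥0) : ℝ)) →
        ((normAbs F (α₁ p : F) : ℝ≥0) : ℝ) * max 1 (max ((normAbs F (p 0 + δ₁ * p 1) : ℝ≥0) : ℝ) ((normAbs F (δ₁ * p 2 - 2⁻¹ * (p 0 + δ₁ * p 1) * (p 0 - δ₁ * p 1)) : ℝ≥0) : ℝ)) = 1) ∧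
      (∀ p : Fin 3 → F, 1 < max 1 (max ((normAbs F (-(p 0 - δ₁ * p 1)) : ℝ≥0) : ℝ)
          ((normAbs F (δ₁ * p 2 - 2⁻¹ * (p 0 + δ₁ * p 1) * (p 0 - δ₁ * p 1) - (p 0 + δ₁ * p 1) * (-(p 0 - δ₁ * p 1))) : ℝ≥0) : ℝ)) →
        ((normAbs F (α₂ p : F) : ℝ≥0) : ℝ) * max 1 (max ((normAbs F (-(p 0 - δ₁ * p 1)) : ℝ≥0) : ℝ)
          ((normAbs F (δ₁ * p 2 - 2⁻¹ * (p 0 + δ₁ * p 1) * (p 0 - δ₁ * p 1) - (p 0 + δ₁ * p 1) * (-(p 0 - δ₁ * p 1))) : ℝ≥0) : ℝ)) = 1) ∧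
      (∀ p : Fin 3 → F, max 1 (max ((normAbs F (p 0 + δ₁ * p 1) : ℝ≥0) : ℝ) ((normAbs F (δ₁ * p 2 - 2⁻¹ * (p 0 + δ₁ * p 1) * (p 0 - δ₁ * p 1)) : ℝ≥0) : ℝ)) = 1 → c₁ p = 1) ∧
      (∀ p : Fin 3 → F, 1 < max 1 (max ((normAbs F (p 0 + δ₁ * p 1) : ℝ≥0) : ℝ) ((normAbs F (δ₁ * p 2 - 2⁻¹ * (p 0 + δ₁ * p 1) * (p 0 - δ₁ * p 1)) : ℝ≥0) : ℝ)) → c₁ p = ((χ₁ (α₁ p) : ℂˣ) : ℂ)) ∧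
      (∀ p : Fin 3 → F, max 1 (max ((normAbs F (-(p 0 - δ₁ * p 1)) : ℝ≥0) : ℝ)
          ((normAbs F (δ₁ * p 2 - 2⁻¹ * (p 0 + δ₁ * p 1) * (p 0 - δ₁ * p 1) - (p 0 + δ₁ * p 1) * (-(p 0 - δ₁ * p 1))) : ℝ≥0) : ℝ)) = 1 → c₂ p = 1) ∧
      (∀ p : Fin 3 → F, 1 < max 1 (max ((normAbs F (-(p 0 - δ₁ * p 1)) : ℝ≥0) : ℝ)
          ((normAbs F (δ₁ * p 2 - 2⁻¹ * (p 0 + δ₁ * p 1) * (p 0 - δ₁ * p 1) - (p 0 + δ₁ * p 1) * (-(p 0 - δ₁ * p 1))) : ℝ≥0) : ℝ)) → c₂ p = ((χ₂ (α₂ p) : ℂˣ) : ℂ)) ∧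
      (∀ p : Fin 3 → F, ω p = c₁ p * c₂ p) := by
  obtain ⟨b, k, α₁, α₂, hbk, hb, hk, h22, h00, hA, hB, hAg, hBg⟩ := exists_iwasawa_torusEntries_split δ₁ hw₀ n hn
  refine ⟨χ₁, χ₂, π, α₁, α₂, fun p => ((χ₁ (α₁ p) : ℂˣ) : ℂ), fun p => ((χ₂ (α₂ p) : ℂˣ) : ℂ), hχ₁, hχ₂, hπ, he₁, he₂, hAg, hBg,
    fun p h1 => chi_torusEntry_eq_one_of_height_eq_one χ₁ hχ₁ (hA p) h1, fun p _ => rfl,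
    fun p h1 => chi_torusEntry_eq_one_of_height_eq_one χ₂ hχ₂ (hB p) h1, fun p _ => rfl, fun p => ?_⟩
  have h := hω p (b p) (k p) (α₂ p) (α₁ p)⁻¹ (hb p) (hk p) (hbk p) (h00 p) (h22 p)
  rw [inv_inv] at h
  exact h

end Summit.HodgeConjecture.HodgeConjecture.Cruxes.H413.K2E1BigCellIwasawaTorusEntrySplitU3Letters

end
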